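import Literature.NumberTheory.LFunctions.ClassGroupSmoothedPsi
import Literature.NumberTheory.LFunctions.ThornerZamanWeight
import Literature.NumberTheory.LFunctions.ClassGroupLogFreeLemmaB
import Literature.NumberTheory.LFunctions.GRHPrimeIdealCountLowerBound
import HarnessLib

/-!
# Unsmoothing: from `ψ̃_C(g_x)` to `θ_C(x)`

Topic `Literature/NumberTheory/LFunctions`, namespace `Literature.NumberTheory.LFunctions.NumberField`.
Everything here is PROVED; `classPsi` is a definition with a body.

* `classPsi K C x = ψ_C(x) = Σ_{n ≤ x} Λ_C(n)`; `θ_C ≤ ψ_C` (`chebyshevThetaIdealClass_le_classPsi`),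
  `Σ_C ψ_C = ψ_K` (`sum_classPsi`), `ψ_C(x) − θ_C(x) ≤ ψ_K(x) − θ_K(x) ≤ π_K(√x) log x ≤ 2n_K √x log x`;
* the smoothing sandwich for the Thorner–Zaman weight `g_x = tzTest (log x) ε`
  (`g_x(log n) = 1` for `√x ≤ n ≤ x`, `= 0` unless `√x e^{−ε} < n < x e^{ε}`, `0 ≤ g_x ≤ 1`):
  `ψ̃_C(g_x) ≤ ψ_C(x e^{ε})` and `ψ_C(x) ≤ ψ̃_C(g_x) + ψ_C(√x)` (`smoothedPsiClass_le_classPsi`,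
  `classPsi_le_smoothedPsiClass_add`), hence the two-sided comparison of `θ_C(x)` with `ψ̃_C`
  (`theta_le_smoothed`, `smoothed_le_theta`). This is [ThornerZaman2019, Lemma 2.3 / (5.3)].

## References

* J. Thorner, A. Zaman, ANT 13 (2019), §2.4 and §5 (unsmoothing). [ThornerZaman2019]
-/

noncomputable section

open Finset Real
open scoped NumberField nonZeroDivisors

namespace Literature.NumberTheory.LFunctions.NumberField

open Literature.NumberTheory.LFunctions.TZWeight

variable {K : Type} [Field K] [NumberField K]

/-! ### `ψ_C` -/

variable (K) in
/-- **`ψ_C(x) = Σ_{n ≤ x} Λ_C(n)`**, the Chebyshev `ψ`-function of the ideal class `C`. [cite: ThornerZaman2019, §2.4] -/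
def classPsi (C : ClassGroup (𝓞 K)) (x : ℝ) : ℝ :=
  ∑ n ∈ Icc 0 ⌊x⌋₊, vonMangoldtClass K C n

/-- `0 ≤ ψ_C(x)`. [folklore] -/
theorem classPsi_nonneg (C : ClassGroup (𝓞 K)) (x : ℝ) : 0 ≤ classPsi K C x :=
  sum_nonneg fun n _ ↦ vonMangoldtClass_nonneg C n

/-- `ψ_C` is monotone. [folklore] -/
theorem classPsi_mono (C : ClassGroup (𝓞 K)) : Monotone (classPsi K C) := by
  intro x y hxy
  exact sum_le_sum_of_subset_of_nonneg (Icc_subset_Icc le_rfl (Nat.floor_le_floor hxy))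
    fun n _ _ ↦ vonMangoldtClass_nonneg C n

/-- `Σ_C Λ_C(n) = Λ_K(n)` for all `n` (both vanish at `n = 0`). [folklore] -/
theorem sum_vonMangoldtClass' (n : ℕ) : ∑ C, vonMangoldtClass K C n = vonMangoldtNorm K n := by
  rcases eq_or_ne n 0 with rfl | hn
  · rw [Finset.sum_eq_zero fun C _ ↦ vonMangoldtClass_zero C]
    rw [vonMangoldtNorm]
    refine (Finset.sum_eq_zero fun I hI ↦ ?_).symm
    rw [mem_idealsOfNorm, Ideal.absNorm_eq_zero_iff] at hI
    rw [hI, idealVonMangoldt_bot]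
  · exact sum_vonMangoldtClass hn

/-- `ψ_K(x) = Σ_{n ≤ x} Λ_K(n)` with the norm-indexed `Λ_K` (`vonMangoldtNorm`). [folklore] -/
theorem chebyshevPsiIdeal_eq_sum_vonMangoldtNorm (x : ℝ) :
    chebyshevPsiIdeal K x = ∑ n ∈ Icc 0 ⌊x⌋₊, vonMangoldtNorm K n := by
  rw [chebyshevPsiIdeal]
  refine sum_congr rfl fun n _ ↦ ?_
  rcases eq_or_ne n 0 with rfl | hn
  · rw [vonMangoldtIdeal_zero, ← sum_vonMangoldtClass' (K := K) 0, Finset.sum_eq_zero fun C _ ↦ vonMangoldtClass_zero C]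
  · rw [vonMangoldtNorm_eq_vonMangoldtIdeal hn]

/-- **`Σ_C ψ_C(x) = ψ_K(x)`**. [folklore] -/
theorem sum_classPsi (x : ℝ) : ∑ C, classPsi K C x = chebyshevPsiIdeal K x := by
  rw [chebyshevPsiIdeal_eq_sum_vonMangoldtNorm]
  unfold classPsi
  rw [sum_comm]
  exact sum_congr rfl fun n _ ↦ sum_vonMangoldtClass' n

/-- `ψ_C(x) ≤ ψ_K(x)`. [folklore] -/
theorem classPsi_le_chebyshevPsiIdeal (C : ClassGroup (𝓞 K)) (x : ℝ) : classPsi K C x ≤ chebyshevPsiIdeal K x := by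
  rw [← sum_classPsi x]
  exact Finset.single_le_sum (fun C' _ ↦ classPsi_nonneg C' x) (mem_univ C)

/-! ### `θ_C ≤ ψ_C` -/

/-- **`θ_C(x) ≤ ψ_C(x)`**: the primes `𝔭` of norm `≤ x` in `C` contribute `Λ(𝔭) = log N𝔭` to `ψ_C`.
[cite: ThornerZaman2019, §2.4] -/
theorem chebyshevThetaIdealClass_le_classPsi (C : ClassGroup (𝓞 K)) (x : ℝ) :
    chebyshevThetaIdealClass K C x ≤ classPsi K C x := by
  classical
  rcases lt_or_ge x 0 with hx | hx
  · rw [chebyshevThetaIdealClass_eq_zero_of_lt_two C (by linarith)]; exact classPsi_nonneg C x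
  rw [chebyshevThetaIdealClass_eq_sum_primeIdealsInClassLE K C hx]
  unfold classPsi vonMangoldtClass
  rw [← Finset.sum_biUnion]
  · -- first rewrite the summand on the primes, then enlarge the index set
    set U := (Icc 0 ⌊x⌋₊).biUnion (idealsOfNorm K) with hU
    set S := (finite_primeIdealsInClassLE C x).toFinset with hS
    have hsub : S ⊆ U := by
      intro P hP
      rw [hS, Set.Finite.mem_toFinset] at hP
      obtain ⟨hprime, hle, hP0, hC⟩ := hP
      rw [hU, Finset.mem_biUnion]
      refine ⟨Ideal.absNorm P, ?_, by rw [mem_idealsOfNorm]⟩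
      rw [mem_Icc]
      exact ⟨Nat.zero_le _, Nat.le_floor hle⟩
    have heq : ∑ P ∈ S, Real.log (Ideal.absNorm P : ℝ) = ∑ P ∈ S, classIndicatorIdeal K C P * idealVonMangoldt P := by
      refine Finset.sum_congr rfl fun P hP ↦ ?_
      rw [hS, Set.Finite.mem_toFinset] at hP
      obtain ⟨hprime, -, hP0, hC⟩ := hP
      have hPbot : P ≠ ⊥ := nonZeroDivisors.ne_zero hP0
      have hind : classIndicatorIdeal K C P = 1 := by
        unfold classIndicatorIdeal
        rw [dif_neg hPbot, if_pos hC]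
      have hΛ : idealVonMangoldt P = Real.log (Ideal.absNorm P) := by
        have := idealVonMangoldt_prime_pow (Ideal.prime_of_isPrime hPbot hprime) one_ne_zero
        rwa [pow_one] at this
      rw [hind, hΛ, one_mul]
    rw [heq]
    exact Finset.sum_le_sum_of_subset_of_nonneg hsub fun I _ _ ↦
      mul_nonneg (classIndicatorIdeal_mem C I).1 (idealVonMangoldt_nonneg I)
  · -- distinct norms give disjoint fibres
    intro m _ n _ hmn
    rw [Function.onFun, Finset.disjoint_left]
    intro I hIm hIn
    rw [mem_idealsOfNorm] at hIm hIn
    exact hmn (hIm.symm.trans hIn)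

/-- **`ψ_C(x) − θ_C(x) ≤ ψ_K(x) − θ_K(x)`** (sum `θ_{C'} ≤ ψ_{C'}` over the other classes). [folklore] -/
theorem classPsi_sub_theta_le (C : ClassGroup (𝓞 K)) (x : ℝ) :
    classPsi K C x - chebyshevThetaIdealClass K C x ≤ chebyshevPsiIdeal K x - chebyshevThetaIdeal K x := by
  classical
  rw [← sum_classPsi x, ← sum_chebyshevThetaIdealClass K x, ← Finset.sum_sub_distrib]
  rw [← Finset.add_sum_erase _ _ (mem_univ C)]
  have : 0 ≤ ∑ C' ∈ univ.erase C, (classPsi K C' x - chebyshevThetaIdealClass K C' x) :=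
    Finset.sum_nonneg fun C' _ ↦ sub_nonneg.2 (chebyshevThetaIdealClass_le_classPsi C' x)
  linarith

/-- **`ψ_C(x) − θ_C(x) ≤ 2 n_K √x log x`** for `x ≥ 1` (`ψ_K − θ_K ≤ π_K(√x) log x`, `π_K(y) ≤ 2 n_K y`). [folklore] -/
theorem classPsi_sub_theta_le_sqrt (C : ClassGroup (𝓞 K)) {x : ℝ} (hx : 1 ≤ x) :
    classPsi K C x - chebyshevThetaIdealClass K C x ≤ 2 * Module.finrank ℚ K * Real.sqrt x * Real.log x := by
  refine (classPsi_sub_theta_le C x).trans ((chebyshevPsiIdeal_sub_chebyshevThetaIdeal_le K hx).trans ?_)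
  have h := primeIdealCount_le_two_mul_finrank_mul K (Real.sqrt_nonneg x)
  exact mul_le_mul_of_nonneg_right h (Real.log_nonneg hx)

/-! ### The smoothing sandwich for the Thorner–Zaman weight -/

/-- **`ψ̃_C(g_x) ≤ ψ_C(x e^{ε})`** for `g_x = tzTest (log x) ε` (`0 ≤ g ≤ 1`, `g(log n) = 0` for `n ≥ x e^ε`).
[cite: ThornerZaman2019, §2.4 Lemma 2.3] -/
theorem smoothedPsiClass_le_classPsi (C : ClassGroup (𝓞 K)) {x ε : ℝ} (hx : 1 < x) (hε : 0 < ε) :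
    smoothedPsiClass K C (tzTest (Real.log x) ε) ≤ classPsi K C (x * Real.exp ε) := by
  have hL : 0 < Real.log x := Real.log_pos hx
  have hx0 : 0 < x := by linarith
  -- truncate at `N = ⌊x e^ε⌋ + 1`
  set N : ℕ := ⌊x * Real.exp ε⌋₊ + 1 with hN
  have hN1 : 1 ≤ N := by omega
  have hxe : 0 < x * Real.exp ε := by positivity
  have hNlog : Real.log x + ε ≤ Real.log N := by
    have h1 : x * Real.exp ε ≤ N := by rw [hN]; push_cast; exact (Nat.lt_floor_add_one _).le
    have := Real.log_le_log hxe h1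
    rwa [Real.log_mul hx0.ne' (Real.exp_pos ε).ne', Real.log_exp] at this
  rw [smoothedPsiClass_eq_sum C (fun u hu ↦ tzTest_eq_zero_of_ge hL hε hu) hN1 hNlog]
  unfold classPsi
  -- `range N = Icc 0 ⌊x e^ε⌋` as index sets
  have hrange : Finset.range N = Icc 0 ⌊x * Real.exp ε⌋₊ := by
    ext n; rw [Finset.mem_range, mem_Icc, hN]; omega
  rw [hrange]
  refine Finset.sum_le_sum fun n _ ↦ ?_
  have h01 := tzTest_mem_Icc (Real.log x) ε (Real.log n)
  have h0 := vonMangoldtClass_nonneg (K := K) C n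
  nlinarith [h01.2]

/-- **`ψ_C(x) ≤ ψ̃_C(g_x) + ψ_C(√x)`** (`g_x(log n) = 1` for `√x ≤ n ≤ x`). [cite: ThornerZaman2019, §2.4 Lemma 2.3] -/
theorem classPsi_le_smoothedPsiClass_add (C : ClassGroup (𝓞 K)) {x ε : ℝ} (hx : 1 < x) (hε : 0 < ε) :
    classPsi K C x ≤ smoothedPsiClass K C (tzTest (Real.log x) ε) + classPsi K C (Real.sqrt x) := by
  have hL : 0 < Real.log x := Real.log_pos hx
  have hx0 : 0 < x := by linarith
  set N : ℕ := ⌊x * Real.exp ε⌋₊ + 1 with hN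
  have hN1 : 1 ≤ N := by omega
  have hxe : 0 < x * Real.exp ε := by positivity
  have hNlog : Real.log x + ε ≤ Real.log N := by
    have h1 : x * Real.exp ε ≤ N := by rw [hN]; push_cast; exact (Nat.lt_floor_add_one _).le
    have := Real.log_le_log hxe h1
    rwa [Real.log_mul hx0.ne' (Real.exp_pos ε).ne', Real.log_exp] at this
  rw [smoothedPsiClass_eq_sum C (fun u hu ↦ tzTest_eq_zero_of_ge hL hε hu) hN1 hNlog]
  unfold classPsi
  -- split `Icc 0 ⌊x⌋` at `⌊√x⌋`
  have hsx : ⌊Real.sqrt x⌋₊ ≤ ⌊x⌋₊ := Nat.floor_le_floor (by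
    rw [Real.sqrt_le_left hx0.le]; nlinarith)
  have hsplit : Icc 0 ⌊x⌋₊ = Icc 0 ⌊Real.sqrt x⌋₊ ∪ Finset.Ioc ⌊Real.sqrt x⌋₊ ⌊x⌋₊ := by
    ext n; simp only [mem_Icc, Finset.mem_union, Finset.mem_Ioc]; omega
  have hdisj : Disjoint (Icc 0 ⌊Real.sqrt x⌋₊) (Finset.Ioc ⌊Real.sqrt x⌋₊ ⌊x⌋₊) := by
    rw [Finset.disjoint_left]; intro n h1 h2; rw [mem_Icc] at h1; rw [Finset.mem_Ioc] at h2; omega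
  rw [hsplit, Finset.sum_union hdisj, add_comm]
  refine add_le_add ?_ le_rfl
  -- on `Ioc ⌊√x⌋ ⌊x⌋` the weight is `1`
  have hsub : Finset.Ioc ⌊Real.sqrt x⌋₊ ⌊x⌋₊ ⊆ Finset.range N := by
    intro n hn
    rw [Finset.mem_Ioc] at hn; rw [Finset.mem_range, hN]
    have : ⌊x⌋₊ ≤ ⌊x * Real.exp ε⌋₊ := Nat.floor_le_floor (by
      have := Real.one_le_exp hε.le; nlinarith)
    omega
  calc ∑ n ∈ Finset.Ioc ⌊Real.sqrt x⌋₊ ⌊x⌋₊, vonMangoldtClass K C n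
      = ∑ n ∈ Finset.Ioc ⌊Real.sqrt x⌋₊ ⌊x⌋₊, vonMangoldtClass K C n * tzTest (Real.log x) ε (Real.log n) := by
        refine Finset.sum_congr rfl fun n hn ↦ ?_
        rw [Finset.mem_Ioc] at hn
        have hn0 : (0 : ℝ) < n := by exact_mod_cast (show 0 < n by omega)
        -- `√x ≤ n ≤ x`, i.e. `L/2 ≤ log n ≤ L`
        have h1 : Real.sqrt x < n := by
          have := Nat.lt_of_floor_lt hn.1
          exact_mod_cast this
        have h2 : (n : ℝ) ≤ x := by
          have := Nat.floor_le hx0.le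
          have : (n : ℝ) ≤ ⌊x⌋₊ := by exact_mod_cast hn.2
          linarith
        have hlog1 : Real.log x / 2 ≤ Real.log n := by
          have := Real.log_le_log (Real.sqrt_pos.2 hx0) h1.le
          rwa [Real.log_sqrt hx0.le] at this
        have hlog2 : Real.log n ≤ Real.log x := Real.log_le_log hn0 h2
        rw [tzTest_eq_one hL hε hlog1 hlog2, mul_one]
    _ ≤ ∑ n ∈ Finset.range N, vonMangoldtClass K C n * tzTest (Real.log x) ε (Real.log n) := by
        refine Finset.sum_le_sum_of_subset_of_nonneg hsub fun n _ _ ↦ ?_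
        exact mul_nonneg (vonMangoldtClass_nonneg C n) (tzTest_mem_Icc _ _ _).1

/-! ### The two-sided comparison of `θ_C` with `ψ̃_C` -/

/-- **Upper bound**: `θ_C(x) ≤ ψ̃_C(g_x) + 2 n_K (log 4 + 4) √x` for `x > 1`
(`θ_C ≤ ψ_C ≤ ψ̃_C(g_x) + ψ_C(√x)`, `ψ_C(√x) ≤ ψ_K(√x) ≤ n_K ψ(√x) ≤ n_K (log 4 + 4) √x`). [cite: ThornerZaman2019, §5 (5.3)] -/
theorem theta_le_smoothed (C : ClassGroup (𝓞 K)) {x ε : ℝ} (hx : 1 < x) (hε : 0 < ε) :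
    chebyshevThetaIdealClass K C x ≤ smoothedPsiClass K C (tzTest (Real.log x) ε) +
      Module.finrank ℚ K * (Real.log 4 + 4) * Real.sqrt x := by
  have h1 := chebyshevThetaIdealClass_le_classPsi (K := K) C x
  have h2 := classPsi_le_smoothedPsiClass_add (K := K) C hx hε
  have h3 : classPsi K C (Real.sqrt x) ≤ Module.finrank ℚ K * (Real.log 4 + 4) * Real.sqrt x := by
    refine (classPsi_le_chebyshevPsiIdeal C _).trans ((chebyshevPsiIdeal_le_finrank_mul_psi K _).trans ?_)
    rw [mul_assoc]
    exact mul_le_mul_of_nonneg_left (Chebyshev.psi_le_const_mul_self (Real.sqrt_nonneg x)) (Nat.cast_nonneg _)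
  linarith

/-- **Lower bound**: `ψ̃_C(g_{x e^{−ε}}) − 2 n_K √x log x ≤ θ_C(x)` for `x e^{−ε} > 1`
(`ψ̃_C(g_{x'}) ≤ ψ_C(x' e^{ε}) = ψ_C(x)` with `x' = x e^{−ε}`, and `ψ_C − θ_C ≤ 2n_K √x log x`). [cite: ThornerZaman2019, §5 (5.3)] -/
theorem smoothed_le_theta (C : ClassGroup (𝓞 K)) {x ε : ℝ} (hε : 0 < ε) (hx : 1 < x * Real.exp (-ε)) :
    smoothedPsiClass K C (tzTest (Real.log (x * Real.exp (-ε))) ε) - 2 * Module.finrank ℚ K * Real.sqrt x * Real.log x ≤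
      chebyshevThetaIdealClass K C x := by
  have h1 := smoothedPsiClass_le_classPsi (K := K) C hx hε
  rw [mul_assoc, ← Real.exp_add, neg_add_cancel, Real.exp_zero, mul_one] at h1
  have hx1 : 1 ≤ x := by
    have : Real.exp (-ε) ≤ 1 := Real.exp_le_one_iff.2 (by linarith)
    have hx0 : 0 < x := by
      by_contra h; rw [not_lt] at h
      have : x * Real.exp (-ε) ≤ 0 := mul_nonpos_of_nonpos_of_nonneg h (Real.exp_pos _).le
      linarith
    nlinarith
  have h2 := classPsi_sub_theta_le_sqrt (K := K) C hx1
  linarith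

end Literature.NumberTheory.LFunctions.NumberField

end
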